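import Mathlib.Algebra.Polynomial.Taylor
import Mathlib.RingTheory.IntegralClosure.IsIntegralClosure.Basic
import Literature.NumberTheory.Transcendental.QuadraticSlopeNormDescent
import HarnessLib

/-!
# Norm descent with a constant shadow: algebraic slope of any degree, depth `≥ d − 1`

The general-degree form of the Galois-norm lever for the residual cusp atoms of the crux
`RigidCore.SparsityTwo` (idea card galois-norm-branch-defect, "constant shadow"; line
cusp-germ-schneider-sparsity, residual stub (★)). Let `f ∈ ℤ[X]` have NO rational root, let
`β ∈ ℝ` be a simple root of `f` (`f(β) = 0 ≠ f'(β)`), `d = deg f`, and let the tail `r` satisfy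
`N^{d-1} · r N → κ` where `κ` is zero or transcendental (e.g. `κ = a/π^m`, `a ∈ ℚ̄`). Then
`βN + r N ∈ ℤ` for only finitely many `N` (`finite_setOf_slope_hit_of_normLimit`).

Proof. At a hit `L − βN = r N =: ε`; the integer `N^d f(L/N) = Σ_i f_i Lⁱ N^{d−i}` equals, by
Taylor expansion of `f` at `β` (`f(β) = 0`), `Σ_{n≥1} (f^{(n)}(β)/n!) εⁿ N^{d−n}`, whose `n = 1` term
tends to `f'(β) κ` and whose `n ≥ 2` terms are `(N^{d−1}ε)ⁿ / N^{d(n−1)} → 0`. An eventually-integral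
convergent sequence is eventually constant `= k ∈ ℤ` (`exists_int_eq_of_tendsto_of_frequently`):
`k ≠ 0` makes `κ = k/f'(β)` algebraic and non-zero — excluded; `k = 0` makes `f(L/N) = 0` — a
rational root. This subsumes `QuadraticSlopeNormDescent` (`d = 2`, depth 1, `κ = (2β−s)c`… up to
normalisation) and, for `f` without rational roots, the Liouville depth criterion (`κ = 0`).
[folklore]

## References

* [folklore] elementary Galois-norm / bounded-norm argument; cf. the `d = 2` case and
  D'Aquino–Macintyre–Terzo arXiv:1206.6747 §3.
-/

noncomputable section

open Filter Polynomial
open _root_.Topology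

namespace Literature.NumberTheory.Transcendental

/-- Polynomial expressions in an algebraic number are algebraic. [folklore] -/
theorem isAlgebraic_aeval_of_isAlgebraic {x : ℂ} (hx : IsAlgebraic ℚ x) (p : ℚ[X]) :
    IsAlgebraic ℚ (aeval x p) := by
  rw [isAlgebraic_iff_isIntegral] at hx ⊢
  exact (adjoin_le_integralClosure hx) (Polynomial.aeval_mem_adjoin_singleton ℚ x)

/-- **Norm descent with constant shadow.** Let `f ∈ ℤ[X]` have no rational root, `β ∈ ℝ` with
`f(β) = 0`, `f'(β) ≠ 0`, `d = natDegree f`; let `r : ℕ → ℂ`, `κ ∈ ℂ` with `N^{d-1} r N → κ` and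
`κ` zero-or-transcendental (`IsAlgebraic ℚ κ → κ = 0`). Then `{N | βN + r N ∈ ℤ}` is finite.
[folklore] -/
theorem finite_setOf_slope_hit_of_normLimit {β : ℝ} {f : ℤ[X]}
    (hnorat : ∀ q : ℚ, aeval (q : ℝ) f ≠ 0) (hroot : aeval β f = 0)
    (hsimple : aeval β (derivative f) ≠ 0) {r : ℕ → ℂ} {κ : ℂ}
    (hr : Tendsto (fun N : ℕ => (N : ℂ) ^ (f.natDegree - 1) * r N) atTop (𝓝 κ))
    (hκ : IsAlgebraic ℚ κ → κ = 0) :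
    Set.Finite {N : ℕ | ∃ L : ℤ, (β : ℂ) * N + r N = L} := by
  classical
  set d := f.natDegree with hd
  -- `f ≠ 0`, `d ≥ 1`
  have hf0 : f ≠ 0 := by rintro rfl; exact hsimple (by simp)
  have hdpos : 0 < d := by
    rw [hd]
    by_contra h0
    push Not at h0
    have h0' : f.natDegree = 0 := Nat.le_zero.mp h0
    have := hsimple
    rw [Polynomial.eq_C_of_natDegree_eq_zero h0', derivative_C, map_zero] at this
    exact this rfl
  -- complexified polynomial and its Taylor expansion at `β`
  set fC : ℂ[X] := f.map (Int.castRingHom ℂ) with hfC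
  have hfCdeg : fC.natDegree = d := by
    rw [hfC, natDegree_map_eq_of_injective (RingHom.injective_int (Int.castRingHom ℂ)), hd]
  have haevalC : ∀ (p : ℤ[X]), aeval (β : ℂ) p = ((aeval β p : ℝ) : ℂ) := fun p => by
    rw [← Complex.coe_algebraMap, Polynomial.aeval_algebraMap_apply]
  have hfCβ : fC.eval (β : ℂ) = 0 := by
    have : fC.eval (β : ℂ) = aeval (β : ℂ) f := by
      rw [hfC, eval_map, aeval_def]; rfl
    rw [this, haevalC, hroot, Complex.ofReal_zero]
  set g : ℂ[X] := taylor (β : ℂ) fC with hg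
  have hg0 : g.coeff 0 = 0 := by rw [hg, taylor_coeff_zero, hfCβ]
  have hg1 : g.coeff 1 = aeval (β : ℂ) (derivative f) := by
    rw [hg, taylor_coeff_one, hfC, derivative_map, eval_map, aeval_def]; rfl
  have hg1ne : g.coeff 1 ≠ 0 := by
    rw [hg1, haevalC]; exact_mod_cast hsimple
  have hgdeg : g.natDegree = d := by rw [hg, natDegree_taylor, hfCdeg]
  have htaylor : ∀ x : ℂ, fC.eval x = g.eval (x - β) := fun x => by
    rw [hg, taylor_eval, sub_add_cancel]
  -- the hit-free model sequence and its limit `g₁ κ`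
  set a : ℕ → ℂ := fun N => ∑ n ∈ Finset.range (d + 1), g.coeff n * (r N) ^ n * (N : ℂ) ^ (d - n)
    with ha
  have halim : Tendsto a atTop (𝓝 (g.coeff 1 * κ)) := by
    have hterm : ∀ n ∈ Finset.range (d + 1), Tendsto (fun N : ℕ => g.coeff n * (r N) ^ n *
        (N : ℂ) ^ (d - n)) atTop (𝓝 (if n = 1 then g.coeff 1 * κ else 0)) := by
      intro n hn
      rw [Finset.mem_range] at hn
      rcases Nat.lt_trichotomy n 1 with h | rfl | h
      · -- `n = 0`: the term is `g₀ N^d = 0`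
        have hn0 : n = 0 := by omega
        subst hn0
        simp only [hg0, zero_mul, if_neg (Nat.zero_ne_one)]
        exact tendsto_const_nhds
      · -- `n = 1`
        simp only [if_true, pow_one]
        have := hr.const_mul (g.coeff 1)
        refine this.congr fun N => ?_
        ring
      · -- `n ≥ 2`: `(N^{d-1} r)^n / N^{d(n-1)} → κ^n · 0`
        rw [if_neg (by omega)]
        have hpow : Tendsto (fun N : ℕ => ((N : ℂ) ^ (d * (n - 1)))⁻¹) atTop (𝓝 0) := by
          have h1 : Tendsto (fun N : ℕ => (N : ℂ)⁻¹) atTop (𝓝 0) := tendsto_inv_atTop_nhds_zero_nat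
          have h2 := h1.pow (d * (n - 1))
          rw [zero_pow (Nat.pos_iff_ne_zero.mp (Nat.mul_pos hdpos (by omega)))] at h2
          refine h2.congr fun N => ?_
          rw [inv_pow]
        have h3 := ((hr.pow n).mul hpow).const_mul (g.coeff n)
        rw [mul_zero, mul_zero] at h3
        refine h3.congr' ?_
        filter_upwards [eventually_gt_atTop 0] with N hN
        have hN : (N : ℂ) ≠ 0 := Nat.cast_ne_zero.mpr hN.ne'
        have hexp : (d - 1) * n = (d - n) + d * (n - 1) := by
          have h1 : 1 ≤ d := hdpos
          have h2 : n ≤ d := by omega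
          zify [h1, h2, (by omega : 1 ≤ n)]
          ring
        rw [mul_pow, ← pow_mul, hexp, pow_add]
        field_simp
    have := tendsto_finsetSum (Finset.range (d + 1)) hterm
    rw [Finset.sum_ite_eq' (Finset.range (d + 1)) 1 (fun _ => g.coeff 1 * κ),
      if_pos (Finset.mem_range.mpr (by omega))] at this
    exact this
  -- at a hit `N ≥ 1` with value `L`, `a N` is the INTEGER `N^d f(L/N) = Σ f_i L^i N^{d-i}`
  have hint : ∀ (N : ℕ), 0 < N → ∀ (L : ℤ), (β : ℂ) * N + r N = L →
      a N = ((∑ i ∈ Finset.range (d + 1), f.coeff i * L ^ i * (N : ℤ) ^ (d - i) : ℤ) : ℂ) := by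
    intro N hN L hL
    have hN : (N : ℂ) ≠ 0 := Nat.cast_ne_zero.mpr hN.ne'
    have hε : r N = (L : ℂ) - (β : ℂ) * N := by linear_combination hL
    -- `a N = N^d g(ε/N)` and `g(ε/N) = fC(L/N)`
    have h1 : a N = (N : ℂ) ^ d * g.eval (r N / N) := by
      rw [eval_eq_sum_range, hgdeg, Finset.mul_sum, ha]
      refine Finset.sum_congr rfl fun n hn => ?_
      rw [Finset.mem_range] at hn
      rw [div_pow]
      have : (N : ℂ) ^ d = (N : ℂ) ^ (d - n) * (N : ℂ) ^ n := by
        rw [← pow_add, Nat.sub_add_cancel (by omega)]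
      rw [this]
      field_simp
    have h2 : g.eval (r N / N) = fC.eval ((L : ℂ) / N) := by
      rw [htaylor, hε]
      congr 1
      field_simp
    have h3 : (N : ℂ) ^ d * fC.eval ((L : ℂ) / N) =
        ((∑ i ∈ Finset.range (d + 1), f.coeff i * L ^ i * (N : ℤ) ^ (d - i) : ℤ) : ℂ) := by
      rw [eval_eq_sum_range, hfCdeg, Finset.mul_sum]
      push_cast
      refine Finset.sum_congr rfl fun i hi => ?_
      rw [Finset.mem_range] at hi
      rw [hfC, coeff_map, div_pow]
      have : (N : ℂ) ^ d = (N : ℂ) ^ (d - i) * (N : ℂ) ^ i := by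
        rw [← pow_add, Nat.sub_add_cancel (by omega)]
      rw [this, eq_intCast]
      field_simp
    rw [h1, h2, h3]
  by_contra hinf
  have hfreqS : ∃ᶠ N : ℕ in atTop, ∃ L : ℤ, (β : ℂ) * N + r N = L :=
    Nat.frequently_atTop_iff_infinite.mpr (Set.not_finite.mp hinf)
  have hfreqa : ∃ᶠ N : ℕ in atTop, ∃ M : ℤ, a N = M := by
    refine ((eventually_gt_atTop 0).and_frequently hfreqS).mono fun N hN => ?_
    obtain ⟨hNpos, L, hL⟩ := hN
    exact ⟨_, hint N hNpos L hL⟩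
  obtain ⟨k, hk, hevk⟩ := exists_int_eq_of_tendsto_of_frequently halim hfreqa
  by_cases hk0 : k = 0
  · -- the norm vanishes at a large hit: a rational root of `f`
    subst hk0
    obtain ⟨N, ⟨hNpos, hNk⟩, L, hL⟩ :=
      (((eventually_gt_atTop 0).and hevk).and_frequently hfreqS).exists
    have hN : (N : ℂ) ≠ 0 := Nat.cast_ne_zero.mpr hNpos.ne'
    have haN : a N = 0 := by
      have := hNk _ (hint N hNpos L hL)
      rw [hint N hNpos L hL, this, Int.cast_zero]
    -- hence `fC (L/N) = 0`, i.e. `f (L/N) = 0` over `ℝ`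
    have h1 : (N : ℂ) ^ d * fC.eval ((L : ℂ) / N) = 0 := by
      have hε : r N = (L : ℂ) - (β : ℂ) * N := by linear_combination hL
      have e1 : a N = (N : ℂ) ^ d * g.eval (r N / N) := by
        rw [eval_eq_sum_range, hgdeg, Finset.mul_sum, ha]
        refine Finset.sum_congr rfl fun n hn => ?_
        rw [Finset.mem_range] at hn
        rw [div_pow]
        have : (N : ℂ) ^ d = (N : ℂ) ^ (d - n) * (N : ℂ) ^ n := by
          rw [← pow_add, Nat.sub_add_cancel (by omega)]
        rw [this]
        field_simp
      have e2 : g.eval (r N / N) = fC.eval ((L : ℂ) / N) := by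
        rw [htaylor, hε]; congr 1; field_simp
      rw [← e2, ← e1, haN]
    have h2 : fC.eval ((L : ℂ) / N) = 0 :=
      (mul_eq_zero.mp h1).resolve_left (pow_ne_zero _ hN)
    apply hnorat ((L : ℚ) / N)
    set q : ℚ := (L : ℚ) / N with hq
    have h3 : aeval ((q : ℝ) : ℂ) f = 0 := by
      rw [Complex.ofReal_ratCast, aeval_def, ← eval_map,
        show algebraMap ℤ ℂ = Int.castRingHom ℂ from rfl, ← hfC]
      have : ((q : ℚ) : ℂ) = (L : ℂ) / N := by rw [hq]; push_cast; ring
      rw [this, h2]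
    rw [← Complex.coe_algebraMap, Polynomial.aeval_algebraMap_apply, Complex.coe_algebraMap,
      Complex.ofReal_eq_zero] at h3
    exact h3
  · -- `κ = k / g₁` would be algebraic and non-zero
    have hκeq : κ = (k : ℂ) / g.coeff 1 := by
      rw [hk]; field_simp
    have hβalg : IsAlgebraic ℚ (β : ℂ) := by
      refine ⟨f.map (algebraMap ℤ ℚ), ?_, ?_⟩
      · exact (Polynomial.map_ne_zero_iff (algebraMap ℤ ℚ).injective_int).mpr hf0
      · rw [Polynomial.aeval_map_algebraMap, haevalC, hroot, Complex.ofReal_zero]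
    have hg1alg : IsAlgebraic ℚ (g.coeff 1) := by
      rw [hg1, ← Polynomial.aeval_map_algebraMap ℚ]
      exact isAlgebraic_aeval_of_isAlgebraic hβalg _
    have hκalg : IsAlgebraic ℚ κ := by
      rw [hκeq, div_eq_mul_inv]
      exact (isAlgebraic_int k).mul (IsAlgebraic.inv_iff.mpr hg1alg)
    have hκ0 : κ = 0 := hκ hκalg
    rw [hκeq, div_eq_zero_iff] at hκ0
    rcases hκ0 with h | h
    · exact hk0 (by exact_mod_cast h)
    · exact hg1ne h

end Literature.NumberTheory.Transcendental

end
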